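import Summits.Ventures.HodgeRepro2.T5CyclotomicSevenInertThree

/-!
# Every rational prime of order `6` modulo `7` stays prime in the field of record `ℚ(ζ₇)`, with `N(v) = p³`

Tier-5 support N3 / §G-N4.2 (seat p3, gen 78). File 253 exhibits the place `(3)` of `ℚ(ζ₇)⁺` that stays prime in
`ℚ(ζ₇)`. The argument uses nothing about `3` beyond «`3` has order `6` modulo `7`», so this file states it for every
rational prime `p` with `orderOf (p : ZMod 7) = 6` — the primes `p ≡ 3, 5 (mod 7)`: `3, 5, 17, 19, 31, …` — and reads
it at `p = 5` as a second numeral instance: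

* `not_dvd_seven_of_orderOf_eq_six` — such a `p` is not `7`;
* `absNorm_of_liesOver_of_orderOf_eq_six` — every prime of `𝓞_{ℚ(ζ₇)}` above `p` has norm `p⁶`;
* **`isPrime_span_natCast_of_orderOf_eq_six`**, **`prime_natCast_of_orderOf_eq_six`** — `(p)` is a prime of
  `𝓞_{ℚ(ζ₇)}`;
* `wPrime`, `vPrime`, `liesOver_vPrime`, **`map_vPrime`** — the places `(p)` of `ℚ(ζ₇)` and of `ℚ(ζ₇)⁺`, and
  «`v 𝓞_K = w`»; **`absNorm_vPrime`** — `N(v) = p³`;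
* `orderOf_five_zmod_seven`, `fact_prime_five`, **`isPrime_span_five`**, `absNorm_vPrime_five` — the instance
  `p = 5`: `(5)` stays prime, `N(v) = 125`.

§8(d): uses an L-value-free non-vanishing device: NO.
-/

open NumberField NumberField.IsCMField IsDedekindDomain IsDedekindDomain.HeightOneSpectrum Module Polynomial
open Summit.Ventures.HodgeRepro2.T5RecordSatakeInert Summit.Ventures.HodgeRepro2.T5InertDegreeAdicCompletion
  Summit.Ventures.HodgeRepro2.T5FinitePlaceSplitIff Summit.Ventures.HodgeRepro2.T5InertGlobalPrime
  Summit.Ventures.HodgeRepro2.T5FinitePlaceCM Summit.Ventures.HodgeRepro2.T5FinitePlaceNormIndex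
  Summit.Ventures.HodgeRepro2.T5CMFieldSquareDatum Summit.Ventures.HodgeRepro2.T5NonSplitPlaceUnitaryGroup
  Summit.Ventures.HodgeRepro2.T5CyclotomicSevenInertThree

namespace Summit.Ventures.HodgeRepro2.T5CyclotomicSevenInertPrime

section Arithmetic

variable (p : ℕ) [hp : Fact p.Prime]

/-- A prime of order `6` modulo `7` is not `7` (the class of `7` is `0`, of order `0`). -/
theorem not_dvd_seven_of_orderOf_eq_six (h6 : orderOf (p : ZMod 7) = 6) : ¬ p ∣ 7 := by
  intro hdvd
  rcases (Nat.prime_seven.eq_one_or_self_of_dvd p hdvd) with h | h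
  · exact hp.out.one_lt.ne' h
  · rw [h, ZMod.natCast_self] at h6
    have h0 : orderOf (0 : ZMod 7) = 0 := orderOf_eq_zero_iff'.mpr fun n hn => by
      rw [zero_pow hn.ne']
      decide
    rw [h0] at h6
    exact absurd h6 (by norm_num)

omit hp in
/-- `N((p)) = p` in `ℤ`. -/
theorem absNorm_span_natCast_int : Ideal.absNorm (Ideal.span {(p : ℤ)}) = p := by
  rw [Ideal.absNorm_span_natCast, Module.finrank_self, pow_one]

end Arithmetic

section Seven

variable (K : Type*) [Field K] [CharZero K] [IsCyclotomicExtension {7} ℚ K]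
variable (p : ℕ) [hp : Fact p.Prime] (h6 : orderOf (p : ZMod 7) = 6)

omit hp in
/-- `N((p)) = p⁶` in `𝓞_{ℚ(ζ₇)}`. -/
theorem absNorm_span_natCast_seven :
    haveI := numberField' K
    Ideal.absNorm (Ideal.span {(p : 𝓞 K)}) = p ^ 6 := by
  haveI := numberField' K
  rw [Ideal.absNorm_span_natCast, RingOfIntegers.rank, finrank_rat_seven K]

include h6 in
/-- **Every prime of `𝓞_{ℚ(ζ₇)}` above `p` has norm `p⁶`** when `p` has order `6` modulo `7` (Mathlib's
`IsCyclotomicExtension.Rat.inertiaDeg_eq_of_not_dvd`). -/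
theorem absNorm_of_liesOver_of_orderOf_eq_six (P : Ideal (𝓞 K)) [P.IsPrime] [P.LiesOver (Ideal.span {(p : ℤ)})] :
    haveI := numberField' K
    Ideal.absNorm P = p ^ 6 := by
  haveI := numberField' K
  have hf : P.inertiaDeg ℤ = 6 := by
    rw [IsCyclotomicExtension.Rat.inertiaDeg_eq_of_not_dvd (m := 7) p K P (not_dvd_seven_of_orderOf_eq_six p h6), h6]
  have h := Ideal.absNorm_pow_inertiaDeg (Ideal.span {(p : ℤ)}) P
  rw [absNorm_span_natCast_int, hf] at h
  exact h.symm

include h6 in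
/-- **`(p)` is a prime of `𝓞_{ℚ(ζ₇)}`** when `p` has order `6` modulo `7` (file 253's argument: `(p)` lies below a
prime above `p` and both have norm `p⁶`). -/
theorem isPrime_span_natCast_of_orderOf_eq_six :
    haveI := numberField' K
    (Ideal.span {(p : 𝓞 K)}).IsPrime := by
  haveI := numberField' K
  haveI : (Ideal.span {(p : ℤ)}).IsPrime :=
    (Ideal.span_singleton_prime (Nat.cast_ne_zero.mpr hp.out.ne_zero)).mpr (Nat.prime_iff_prime_int.mp hp.out)
  obtain ⟨⟨P, hP, hPo⟩⟩ := Ideal.nonempty_primesOver (S := 𝓞 K) (Ideal.span {(p : ℤ)})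
  have hle : Ideal.span {(p : 𝓞 K)} ≤ P := by
    rw [Ideal.span_le, Set.singleton_subset_iff, SetLike.mem_coe]
    have hmem : (p : ℤ) ∈ Ideal.span {(p : ℤ)} := Ideal.mem_span_singleton_self (p : ℤ)
    rw [Ideal.mem_of_liesOver P (Ideal.span {(p : ℤ)}) p, map_natCast] at hmem
    exact hmem
  have hne : Ideal.span {(p : 𝓞 K)} ≠ ⊥ :=
    (Ideal.span_singleton_eq_bot).not.mpr (Nat.cast_ne_zero.mpr hp.out.ne_zero)
  have heq : Ideal.span {(p : 𝓞 K)} = P :=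
    eq_of_le_of_absNorm_eq hle hne
      ((absNorm_span_natCast_seven K p).trans (absNorm_of_liesOver_of_orderOf_eq_six K p h6 P).symm)
  rw [heq]
  exact hP

include h6 in
/-- `p` is a prime element of `𝓞_{ℚ(ζ₇)}` when it has order `6` modulo `7`. -/
theorem prime_natCast_of_orderOf_eq_six :
    haveI := numberField' K
    Prime (p : 𝓞 K) := by
  haveI := numberField' K
  exact (Ideal.span_singleton_prime (Nat.cast_ne_zero.mpr hp.out.ne_zero)).mp
    (isPrime_span_natCast_of_orderOf_eq_six K p h6)

/-- **The place `(p)` of `ℚ(ζ₇)`** for a prime `p` of order `6` modulo `7`. -/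
noncomputable def wPrime : HeightOneSpectrum (𝓞 K) :=
  haveI := numberField' K
  { asIdeal := Ideal.span {(p : 𝓞 K)}
    isPrime := isPrime_span_natCast_of_orderOf_eq_six K p h6
    ne_bot := (Ideal.span_singleton_eq_bot).not.mpr (Nat.cast_ne_zero.mpr hp.out.ne_zero) }

/-- The ideal of `wPrime` is `(p)`. -/
theorem wPrime_asIdeal : (wPrime K p h6).asIdeal = Ideal.span {(p : 𝓞 K)} := rfl

/-- `p ∈ wPrime`. -/
theorem natCast_mem_wPrime : (p : 𝓞 K) ∈ (wPrime K p h6).asIdeal := Ideal.mem_span_singleton_self _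

omit [IsCyclotomicExtension {7} ℚ K] in
/-- `p ≠ 0` in `𝓞_{ℚ(ζ₇)}`. -/
theorem natCast_ne_zero' : (p : 𝓞 K) ≠ 0 := Nat.cast_ne_zero.mpr hp.out.ne_zero

/-- **The place `(p)` of `ℚ(ζ₇)⁺`**, constructed as the contraction of `wPrime`. -/
noncomputable def vPrime : HeightOneSpectrum (𝓞 (maximalRealSubfield K)) where
  asIdeal := Ideal.comap (algebraMap (𝓞 (maximalRealSubfield K)) (𝓞 K)) (wPrime K p h6).asIdeal
  isPrime := Ideal.IsPrime.comap _
  ne_bot := Ideal.comap_ne_bot_of_integral_mem (natCast_ne_zero' K p) (natCast_mem_wPrime K p h6)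
    (Algebra.IsIntegral.isIntegral _)

/-- The ideal of `vPrime` is the contraction of `(p)`. -/
theorem vPrime_asIdeal :
    (vPrime K p h6).asIdeal =
      Ideal.comap (algebraMap (𝓞 (maximalRealSubfield K)) (𝓞 K)) (wPrime K p h6).asIdeal :=
  rfl

/-- `p ∈ vPrime`. -/
theorem natCast_mem_vPrime : (p : 𝓞 (maximalRealSubfield K)) ∈ (vPrime K p h6).asIdeal := by
  rw [vPrime_asIdeal, Ideal.mem_comap, map_natCast]
  exact natCast_mem_wPrime K p h6

/-- `wPrime` lies over `vPrime`. -/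
instance liesOver_vPrime : (wPrime K p h6).asIdeal.LiesOver (vPrime K p h6).asIdeal := ⟨rfl⟩

/-- **`p` stays prime in `ℚ(ζ₇)`, from `ℚ(ζ₇)⁺`**: `(p) 𝓞_K = (p)` — the hypothesis `hmap` of files 233 / 236 at
every such place. -/
theorem map_vPrime :
    Ideal.map (algebraMap (𝓞 (maximalRealSubfield K)) (𝓞 K)) (vPrime K p h6).asIdeal =
      (wPrime K p h6).asIdeal := by
  refine le_antisymm Ideal.map_comap_le ?_
  rw [wPrime_asIdeal, Ideal.span_le, Set.singleton_subset_iff]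
  have h := Ideal.mem_map_of_mem (algebraMap (𝓞 (maximalRealSubfield K)) (𝓞 K)) (natCast_mem_vPrime K p h6)
  rwa [map_natCast] at h

/-- **`N(vPrime) = p³`**: `N(w) = N(v)²` (file 207's `absNorm_eq_sq`, `e = 1` and `[K_w : K⁺_v] = 2` from
«stays prime») and `N(w) = p⁶`. -/
theorem absNorm_vPrime :
    haveI := numberField' K; haveI := isCMField' K
    Ideal.absNorm (vPrime K p h6).asIdeal = p ^ 3 := by
  haveI := numberField' K
  haveI := isCMField' K
  have he := ramificationIdx'_eq_one_of_staysPrime (vPrime K p h6) (wPrime K p h6) (map_vPrime K p h6)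
  obtain ⟨θ, y, hθ, hy⟩ := exists_sq_eq_and_complexConj_ne K
  have hf := finrank_eq_two K (vPrime K p h6) (wPrime K p h6) hθ hy
    (not_isSquare_of_staysPrime K (vPrime K p h6) (wPrime K p h6) hθ hy (map_vPrime K p h6))
  have h := absNorm_eq_sq (vPrime K p h6) (wPrime K p h6) he hf
  rw [wPrime_asIdeal, absNorm_span_natCast_seven K p] at h
  have h6' : p ^ 6 = (p ^ 3) ^ 2 := by rw [← pow_mul]
  rw [h6'] at h
  exact (Nat.pow_left_injective two_ne_zero h).symm

end Seven

section Five

variable (K : Type*) [Field K] [CharZero K] [IsCyclotomicExtension {7} ℚ K]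

/-- `5` has multiplicative order `6` modulo `7`. -/
theorem orderOf_five_zmod_seven : orderOf (5 : ZMod 7) = 6 := by
  rw [orderOf_eq_iff (by norm_num)]
  decide

/-- `orderOf ((5 : ℕ) : ZMod 7) = 6` (the cast form used by the generic theorems). -/
theorem orderOf_natCast_five_zmod_seven : orderOf ((5 : ℕ) : ZMod 7) = 6 := by
  rw [Nat.cast_ofNat]
  exact orderOf_five_zmod_seven

/-- `5` is prime (as a `Fact`, for the generic theorems). -/
theorem fact_prime_five : Fact (Nat.Prime 5) := ⟨by norm_num⟩

/-- **`(5)` is a prime of `𝓞_{ℚ(ζ₇)}`.** -/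
theorem isPrime_span_five :
    haveI := numberField' K
    (Ideal.span {(5 : 𝓞 K)}).IsPrime := by
  haveI := numberField' K
  haveI := fact_prime_five
  have h := isPrime_span_natCast_of_orderOf_eq_six K 5 orderOf_natCast_five_zmod_seven
  rwa [Nat.cast_ofNat] at h

/-- **`N(vPrime 5) = 125`**: the place `(5)` of `ℚ(ζ₇)⁺` stays prime in `ℚ(ζ₇)` with norm `5³`. -/
theorem absNorm_vPrime_five :
    haveI := numberField' K; haveI := isCMField' K; haveI := fact_prime_five
    Ideal.absNorm (vPrime K 5 orderOf_natCast_five_zmod_seven).asIdeal = 125 := by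
  haveI := numberField' K
  haveI := isCMField' K
  haveI := fact_prime_five
  rw [absNorm_vPrime K 5 orderOf_natCast_five_zmod_seven]
  norm_num

end Five

end Summit.Ventures.HodgeRepro2.T5CyclotomicSevenInertPrime
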